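/-
Copyright: the b2b-balaban cell (near-miss cell 7), T⁴-continuum CRUX team (coordinator ruling e34b3e0c item (2)),
lineage t4-ne7b-formalise-leaf-02 (gen 127; E-side ∕ key-readings). Released under the licence of the surrounding project.
-/
import Summits.QuantumFields.BalabanUV.T4Continuum.Spine.NE7b.GaussianInducedMeanDecay

/-!
# THE BUFFER IS VOLUME-FREE: decay sums under a lattice-growth letter, and the induced-mean energy `B₀` without `#D`
# (row NE7b, node U5c; the (R1″) ∕ (R1′b) residual of the LCS road in MODEL form)

Cell `pub-balaban/t4`, spine estimate NE7b (`T4WeightBudget.RelWeightBound`; the cell's OWN estimate — NOT PRINTED in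
[Bałaban 1983–89], NOT PROVED).  [folklore] finite sums ∕ real analysis over the kernel objects of the OWNER lineage
`t4-ne7b-p1` (`…GaussianShiftedFibre`) and of `pub-balaban-gaps` ne6 (`…GaussianInducedMeanDecay`); NOTHING of Bałaban's is
named, valued or asserted; no `T4Continuum/Support` leaf typed (FREEZE (0)); 0 `def`, 0 `sorry`.

WHY.  `…GaussianInducedMeanDecay` (gaps-ne6 g10, p363020) discharges the OWNER's displayed induced-mean hypothesis
`hB : mᵀQm ≤ B₀` (`…GaussianShiftedFibre.shiftedMoment_le_of_inducedMean_le`) from a decay letter `|S⁻¹ i k| ≤ C·e^{−μ d(i,k)}`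
and a BUFFER `d(Z, D) ≥ R`, with `B₀ := q₀·#Z·(C·V·#D·e^{−μR})²`: the CARDINAL of the interface `D` enters (its
`sum_exp_le_card_mul_exp`), so the buffer making `B₀ = O(q₀#Z)` grows like `log #D` with the far component (crux refuter v70
κ-ne7bref-g67-1; idea-1 g59 S-59-2: «the SUM form + the lattice growth bound `Σ_{r≥R} N_d(r)e^{−μr}` is VOLUME-FREE — one
folklore lemma»).  THIS FILE is that lemma and its junctions: under a GROWTH LETTER for the balls of the pseudo-distance
around the pinned index — `#{l ∈ D | d(j,l) < r+1} ≤ A·e^{ν(r+1)}` (`0 ≤ ν < μ`), or `≤ A·(r+1)^k` — the decay sum is a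
geometric tail `≤ Γ·e^{−(μ−ν)R}`, `Γ = A·e^ν∕(1 − e^{−(μ−ν)})`, FREE OF `#D` and of the volume; on the site lattice `ℤ^d` (any
finite piece, any internal multiplicity `m`) the letter HOLDS with `A = m·2^d`, `k = d` (box count `(2r+1)^d`).

WHAT IS PROVED ([folklore]):
* §1 `sum_pow_le_of_le` (finite geometric tail), `sum_exp_le_sum_shells` (the SHELL FORM `Σ_r N(r)e^{−μr}`, no growth
  hypothesis), **`sum_exp_le_of_growth`** (`Σ_{l∈D} e^{−μ d(j,l)} ≤ Γ·e^{−(μ−ν)R}` under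
  the exponential letter and the buffer; shells `l ↦ ⌊d(j,l)⌋₊` + `Finset.sum_comp` + `geom_sum_Ico_le_of_lt_one`),
  `pow_le_factorial_div_mul_exp` (`t^k ≤ k!∕ν^k·e^{νt}`), **`sum_exp_le_of_polyGrowth`** (polynomial letter ⟹
  `≤ A·(k!∕(μ∕2)^k)·e^{μ∕2}∕(1−e^{−μ∕2})·e^{−(μ∕2)R}` — half the rate pays the polynomial, as print's `c₁(δ₁) = (2∕δ₁)K₁(d, δ₁∕2)`
  in [B12] (4.22), LOCATOR only).
* §2 THE LATTICE MODEL: `card_box` (`#Icc(c − r, c + r) = (2r+1)^d` in `Fin d → ℤ`), **`card_filter_le_of_siteReading`** (site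
  reading `ξ : n → (Fin d → ℤ)`, fibres `≤ m` on `D`, coordinate differences `≤ d(j,l)` ⟹ `#{l ∈ D | d(j,l) < r+1} ≤ m·(2r+1)^d`),
  **`polyGrowth_of_siteReading`** (`A = m·2^d`, `k = d`), `sum_exp_le_of_siteReading` — the letter DISCHARGED on every finite
  piece of `ℤ^d` with bounded internal multiplicity, uniformly in the piece.
* §3 JUNCTIONS BY NAME to `…GaussianInducedMeanDecay` ∕ `…GaussianShiftedFibre`: **`abs_inv_mulVec_le_growth`** (`|m_j| ≤
  C·V·Γ·e^{−(μ−ν)R}` = `abs_inv_mulVec_le_sum` + §1), **`rowSum_response_le_growth`** (σ-1's `t_Z` WITHOUT `#D`),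
  **`inducedMeanEnergy_le_of_growth`** (`mᵀQm ≤ q₀·#Z·(C·V·Γ·e^{−(μ−ν)R})²`: `B₀` VOLUME-FREE, `O(q₀#Z)` as soon as
  `e^{(μ−ν)R} ≥ C·V·Γ` — a buffer INDEPENDENT of the far component), `inducedMeanEnergy_le_of_banded_growth` (`C = 2∕σ`,
  Combes–Thomas), **`shiftedMoment_le_of_growth`** (= the OWNER's `shiftedMoment_le_of_inducedMean_le`, `hB` DISCHARGED
  volume-free), `inducedMeanEnergy_le_of_polyGrowth`, **`inducedMeanEnergy_le_of_siteReading`** (on any finite piece of `ℤ^d`: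
  `B₀ := q₀·#Z·(C·V·(m·2^d·(d!∕(μ∕2)^d)·e^{μ∕2}∕(1−e^{−μ∕2}))·e^{−(μ∕2)R})²`).
* §4 a decided toy (`Fin 3` read on `ℤ¹`: the site-reading hypotheses are jointly inhabited).
NOT HERE (honest): that Bałaban's fluctuation forms and 𝐑-operation SUPPLY the decay letter (`C, μ` uniform in the running
coupling — print's random-walk expansions [B13]∕[B14]), the interface reading `D, V` and a buffer `R` with `e^{(μ−ν)R} ≥ C·V·Γ`
is the (A1c) INSTANCE (NC-NE7b-α UNRULED) — not claimed; the window clause (R1′c), the non-Gaussian remainder (R2′), the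
identification (A3); anything of Bałaban's.  BY-NAME EFFECT ON THE WALL: NONE (a model supplier removing the far-volume
letter `#D` from one displayed hypothesis).  NE7b NOT PRINTED ∕ NOT PROVED; spine PROVED 0∕9; rung (B)+1 on ONE finite T⁴ —
NOT infinite volume, NOT the mass gap, NOT Clay.  HONEST DEPENDENCY: continuum YM on T⁴ ⇐ BetaPertH ∧ nine spine estimates
(0∕9 proved); BetaPertH ⇐ (D1) ∧ (D4) ∧ CAP+tail; G-an2-4 gates asym, D1 and NE2∕3∕4.
-/

set_option autoImplicit false
open Matrix Finset MeasureTheory Real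
open Summit.QuantumFields.BalabanUV.T4Continuum.NE7b.GaussianShiftedFibre
open Summit.QuantumFields.BalabanUV.T4Continuum.NE7b.GaussianInducedMeanDecay

namespace Summit.QuantumFields.BalabanUV.T4Continuum.NE7b.InducedMeanLatticeGrowth
variable {n : Type*}

/-! ## §1 Decay sums under a ball-growth letter are geometric tails (no `#D`) -/

/-- A finite geometric tail: if every index of `T` is `≥ R` and `0 ≤ x < 1`, then `Σ_{r∈T} x^r ≤ x^R∕(1−x)`. [folklore] -/
theorem sum_pow_le_of_le (T : Finset ℕ) {x : ℝ} (hx0 : 0 ≤ x) (hx1 : x < 1) {R : ℕ} (hT : ∀ r ∈ T, R ≤ r) :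
    ∑ r ∈ T, x ^ r ≤ x ^ R / (1 - x) := by
  have hsub : T ⊆ Finset.Ico R (T.sup id + 1) := fun r hr =>
    Finset.mem_Ico.2 ⟨hT r hr, Nat.lt_succ_of_le (Finset.le_sup (f := id) hr)⟩
  calc ∑ r ∈ T, x ^ r ≤ ∑ r ∈ Finset.Ico R (T.sup id + 1), x ^ r :=
        Finset.sum_le_sum_of_subset_of_nonneg hsub fun r _ _ => pow_nonneg hx0 r
    _ ≤ x ^ R / (1 - x) := geom_sum_Ico_le_of_lt_one hx0 hx1

/-- A growth letter has a non-negative constant. [folklore] -/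
theorem growthConst_nonneg (D : Finset n) (d : n → n → ℝ) (j : n) {ν A : ℝ}
    (hgrowth : ∀ r : ℕ, ((D.filter fun l => d j l < r + 1).card : ℝ) ≤ A * exp (ν * (r + 1))) : 0 ≤ A := by
  by_contra hA
  have h1 : A * exp (ν * ((0 : ℕ) + 1)) < 0 := mul_neg_of_neg_of_pos (not_le.1 hA) (exp_pos _)
  exact absurd ((Nat.cast_nonneg _).trans (hgrowth 0)) (not_le.2 h1)

/-- **THE SHELL FORM** (the refuter's `Σ_r N(r)·e^{−μr}` verbatim, no growth hypothesis): with the shell index `⌊d(j,l)⌋₊`,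
`Σ_{l∈D} e^{−μ d(j,l)} ≤ Σ_{r ∈ shells of D} #{l ∈ D | ⌊d(j,l)⌋₊ = r}·e^{−μr}` whenever `μ ≥ 0` and `d(j, ·) ≥ 0` on `D`
(each member of shell `r` weighs at most `e^{−μr}`; `Finset.sum_comp`). [folklore] -/
theorem sum_exp_le_sum_shells (D : Finset n) (d : n → n → ℝ) (j : n) {μ : ℝ} (hμ : 0 ≤ μ) (hd0 : ∀ l ∈ D, 0 ≤ d j l) :
    ∑ l ∈ D, exp (-(μ * d j l)) ≤ ∑ r ∈ D.image (fun l => ⌊d j l⌋₊),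
      ((D.filter fun l => ⌊d j l⌋₊ = r).card : ℝ) * exp (-(μ * (r : ℝ))) := by
  classical
  have step1 : ∑ l ∈ D, exp (-(μ * d j l)) ≤ ∑ l ∈ D, exp (-(μ * (⌊d j l⌋₊ : ℝ))) :=
    Finset.sum_le_sum fun l hl => exp_le_exp.2 (neg_le_neg (mul_le_mul_of_nonneg_left (Nat.floor_le (hd0 l hl)) hμ))
  refine step1.trans (le_of_eq ?_)
  rw [Finset.sum_comp (fun r : ℕ => exp (-(μ * (r : ℝ)))) (fun l => ⌊d j l⌋₊)]
  exact Finset.sum_congr rfl fun r _ => by rw [nsmul_eq_mul]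

/-- **DECAY SUMS UNDER A BALL-GROWTH LETTER ARE VOLUME-FREE.**  Let `d(j, ·)` be a real pseudo-distance from the pinned
index `j`, let the interface `D` sit at distance `≥ R` (`R : ℕ`) from `j`, and suppose the GROWTH LETTER: for every
`r : ℕ` the number of `l ∈ D` with `d(j,l) < r + 1` is at most `A·e^{ν(r+1)}`, with `0 ≤ ν < μ`.  Then
`Σ_{l∈D} e^{−μ d(j,l)} ≤ A·e^ν∕(1 − e^{−(μ−ν)}) · e^{−(μ−ν)R}` — no `#D`, no volume.  (Shells `⌊d(j,l)⌋₊ = r` have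
`≤ A e^{ν(r+1)}` members each weighing `≤ e^{−μr}`; the shells `r ≥ R` sum geometrically.) [folklore] -/
theorem sum_exp_le_of_growth (D : Finset n) (d : n → n → ℝ) (j : n) {μ ν A : ℝ} (hν : 0 ≤ ν) (hνμ : ν < μ)
    (hgrowth : ∀ r : ℕ, ((D.filter fun l => d j l < r + 1).card : ℝ) ≤ A * exp (ν * (r + 1)))
    {R : ℕ} (hR : ∀ l ∈ D, (R : ℝ) ≤ d j l) :
    ∑ l ∈ D, exp (-(μ * d j l)) ≤ A * exp ν / (1 - exp (-(μ - ν))) * exp (-((μ - ν) * R)) := by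
  classical
  have hA : 0 ≤ A := growthConst_nonneg D d j hgrowth
  have hμ : 0 < μ := lt_of_le_of_lt hν hνμ
  set s : n → ℕ := fun l => ⌊d j l⌋₊ with hs  -- the shell index
  have hd0 : ∀ l ∈ D, 0 ≤ d j l := fun l hl => (Nat.cast_nonneg R).trans (hR l hl)
  have hRs : ∀ l ∈ D, R ≤ s l := fun l hl => (Nat.le_floor_iff (hd0 l hl)).2 (hR l hl)
  -- a shell is inside the next ball
  have step3 : ∀ r ∈ D.image s, ((D.filter fun l => s l = r).card : ℝ) ≤ A * exp (ν * (r + 1)) := by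
    refine fun r _ => le_trans ?_ (hgrowth r)
    have hsub : (D.filter fun l => s l = r) ⊆ D.filter fun l => d j l < r + 1 := fun l hl => by
      simp only [Finset.mem_filter] at hl ⊢
      exact ⟨hl.1, by rw [← hl.2]; exact Nat.lt_floor_add_one _⟩
    exact_mod_cast Finset.card_le_card hsub
  -- the geometric tail over the shells `r ≥ R`
  have hx0 : 0 ≤ exp (-(μ - ν)) := (exp_pos _).le
  have hx1 : exp (-(μ - ν)) < 1 := Real.exp_lt_one_iff.2 (by linarith)
  have step4 : ∑ r ∈ D.image s, exp (-(μ - ν)) ^ r ≤ exp (-(μ - ν)) ^ R / (1 - exp (-(μ - ν))) :=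
    sum_pow_le_of_le (D.image s) hx0 hx1 fun r hr => by
      obtain ⟨l, hl, rfl⟩ := Finset.mem_image.1 hr; exact hRs l hl
  have hpow : ∀ r : ℕ, exp (-(μ - ν)) ^ r = exp (-((μ - ν) * r)) := fun r => by rw [← Real.exp_nat_mul]; ring_nf
  calc ∑ l ∈ D, exp (-(μ * d j l))
      ≤ ∑ r ∈ D.image s, ((D.filter fun l => s l = r).card : ℝ) * exp (-(μ * (r : ℝ))) :=
        sum_exp_le_sum_shells D d j hμ.le hd0
    _ ≤ ∑ r ∈ D.image s, A * exp (ν * (r + 1)) * exp (-(μ * (r : ℝ))) :=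
        Finset.sum_le_sum fun r hr => mul_le_mul_of_nonneg_right (step3 r hr) (exp_pos _).le
    _ = A * exp ν * ∑ r ∈ D.image s, exp (-(μ - ν)) ^ r := by
        rw [Finset.mul_sum]
        refine Finset.sum_congr rfl fun r _ => ?_
        rw [hpow r, mul_assoc, mul_assoc, ← Real.exp_add, ← Real.exp_add]; ring_nf
    _ ≤ A * exp ν * (exp (-(μ - ν)) ^ R / (1 - exp (-(μ - ν)))) :=
        mul_le_mul_of_nonneg_left step4 (mul_nonneg hA (exp_pos _).le)
    _ = A * exp ν / (1 - exp (-(μ - ν))) * exp (-((μ - ν) * R)) := by rw [hpow R]; ring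

/-- `t^k ≤ k!∕ν^k · e^{νt}` for `t ≥ 0`, `ν > 0` (Mathlib's `Real.pow_div_factorial_le_exp` at `νt`). [folklore] -/
theorem pow_le_factorial_div_mul_exp {ν : ℝ} (hν : 0 < ν) (k : ℕ) {t : ℝ} (ht : 0 ≤ t) :
    t ^ k ≤ (k.factorial : ℝ) / ν ^ k * exp (ν * t) := by
  have h := Real.pow_div_factorial_le_exp (x := ν * t) (mul_nonneg hν.le ht) k
  rw [mul_pow, div_le_iff₀ (by positivity)] at h
  rw [div_mul_eq_mul_div, le_div_iff₀ (pow_pos hν k)]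
  calc t ^ k * ν ^ k = ν ^ k * t ^ k := mul_comm _ _
    _ ≤ exp (ν * t) * k.factorial := h
    _ = k.factorial * exp (ν * t) := mul_comm _ _

/-- A polynomial growth letter is an exponential one at any rate `ν > 0`: `A·(r+1)^k ≤ (A·k!∕ν^k)·e^{ν(r+1)}`. [folklore] -/
theorem growth_of_polyGrowth (D : Finset n) (d : n → n → ℝ) (j : n) {A : ℝ} {k : ℕ} (hA : 0 ≤ A)
    (hgrowth : ∀ r : ℕ, ((D.filter fun l => d j l < r + 1).card : ℝ) ≤ A * ((r : ℝ) + 1) ^ k)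
    {ν : ℝ} (hν : 0 < ν) (r : ℕ) :
    ((D.filter fun l => d j l < r + 1).card : ℝ) ≤ A * ((k.factorial : ℝ) / ν ^ k) * exp (ν * (r + 1)) := by
  refine (hgrowth r).trans ?_
  have h := pow_le_factorial_div_mul_exp hν k (t := (r : ℝ) + 1) (by positivity)
  calc A * ((r : ℝ) + 1) ^ k ≤ A * ((k.factorial : ℝ) / ν ^ k * exp (ν * ((r : ℝ) + 1))) :=
        mul_le_mul_of_nonneg_left h hA
    _ = A * ((k.factorial : ℝ) / ν ^ k) * exp (ν * (r + 1)) := by ring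

/-- **THE POLYNOMIAL FORM** («`Σ_{r≥R} N_d(r)e^{−μr}`»): under the polynomial ball-growth letter `#{l ∈ D | d(j,l) < r+1}
≤ A·(r+1)^k` (`A ≥ 0`, `μ > 0`) and the buffer `d(j, D) ≥ R`,
`Σ_{l∈D} e^{−μ d(j,l)} ≤ A·(k!∕(μ∕2)^k)·e^{μ∕2}∕(1 − e^{−μ∕2}) · e^{−(μ∕2)R}` — half the rate pays the polynomial; no `#D`.
[folklore] -/
theorem sum_exp_le_of_polyGrowth (D : Finset n) (d : n → n → ℝ) (j : n) {μ A : ℝ} {k : ℕ} (hμ : 0 < μ) (hA : 0 ≤ A)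
    (hgrowth : ∀ r : ℕ, ((D.filter fun l => d j l < r + 1).card : ℝ) ≤ A * ((r : ℝ) + 1) ^ k)
    {R : ℕ} (hR : ∀ l ∈ D, (R : ℝ) ≤ d j l) :
    ∑ l ∈ D, exp (-(μ * d j l)) ≤
      A * ((k.factorial : ℝ) / (μ / 2) ^ k) * exp (μ / 2) / (1 - exp (-(μ / 2))) * exp (-(μ / 2 * R)) := by
  have h := sum_exp_le_of_growth D d j (μ := μ) (ν := μ / 2) (A := A * ((k.factorial : ℝ) / (μ / 2) ^ k))
    (by positivity) (by linarith) (growth_of_polyGrowth D d j hA hgrowth (half_pos hμ)) hR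
  have e : μ - μ / 2 = μ / 2 := by ring
  rw [e] at h; exact h

/-! ## §2 The lattice model: the growth letter holds on every finite piece of `ℤ^d`, uniformly in the piece -/

section Lattice
variable {dd : ℕ}

/-- The box count in `ℤ^d`: `#Icc(c − r·𝟙, c + r·𝟙) = (2r+1)^d`. [folklore] -/
theorem card_box (c : Fin dd → ℤ) (r : ℕ) :
    (Finset.Icc (fun i => c i - (r : ℤ)) (fun i => c i + (r : ℤ))).card = (2 * r + 1) ^ dd := by
  rw [Pi.card_Icc]
  have h : ∀ i : Fin dd, (Finset.Icc (c i - (r : ℤ)) (c i + (r : ℤ))).card = 2 * r + 1 := fun i => by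
    have e : c i + (r : ℤ) + 1 - (c i - (r : ℤ)) = ((2 * r + 1 : ℕ) : ℤ) := by push_cast; ring
    rw [Int.card_Icc, e, Int.toNat_natCast]
  rw [Finset.prod_congr rfl fun i _ => h i, Finset.prod_const, Finset.card_univ, Fintype.card_fin]

/-- **THE GROWTH LETTER ON THE LATTICE.**  Let the indices be READ on the site lattice by `ξ : n → (Fin d → ℤ)` (site of an
index; internal indices — colour, direction, component — share a site) with fibres of size `≤ m` on `D`, and let the
pseudo-distance dominate the coordinate differences: `|ξ_l(i) − ξ_j(i)| ≤ d(j,l)` for `l ∈ D` (true for the `ℓ∞` and the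
`ℓ¹` site distances and for anything larger).  Then `#{l ∈ D | d(j,l) < r+1} ≤ m·(2r+1)^d` — uniformly in `D`, in the
piece of the lattice and in the volume. [folklore] -/
theorem card_filter_le_of_siteReading [DecidableEq n] (D : Finset n) (d : n → n → ℝ) (j : n)
    (ξ : n → (Fin dd → ℤ)) {m : ℕ} (hmult : ∀ w, (D.filter fun l => ξ l = w).card ≤ m)
    (hcoord : ∀ l ∈ D, ∀ i, |((ξ l i : ℤ) : ℝ) - ((ξ j i : ℤ) : ℝ)| ≤ d j l) (r : ℕ) :
    (D.filter fun l => d j l < r + 1).card ≤ m * (2 * r + 1) ^ dd := by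
  set F := D.filter fun l => d j l < r + 1 with hF
  -- the read sites of `F` lie in the box of radius `r` around the site of `j`
  have himg : F.image ξ ⊆ Finset.Icc (fun i => ξ j i - (r : ℤ)) (fun i => ξ j i + (r : ℤ)) := by
    intro w hw
    obtain ⟨l, hl, rfl⟩ := Finset.mem_image.1 hw
    rw [hF, Finset.mem_filter] at hl
    have key : ∀ i, |ξ l i - ξ j i| ≤ (r : ℤ) := fun i => by
      have h1 : |((ξ l i : ℤ) : ℝ) - ((ξ j i : ℤ) : ℝ)| < (r : ℝ) + 1 := (hcoord l hl.1 i).trans_lt hl.2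
      have h2 : (((|ξ l i - ξ j i| : ℤ)) : ℝ) < ((r : ℤ) : ℝ) + 1 := by
        rw [Int.cast_abs, Int.cast_sub]; exact_mod_cast h1
      exact Int.lt_add_one_iff.1 (by exact_mod_cast h2)
    rw [Finset.mem_Icc]
    exact ⟨fun i => by linarith [(abs_le.1 (key i)).1], fun i => by linarith [(abs_le.1 (key i)).2]⟩
  have hfib : ∀ w ∈ F.image ξ, (F.filter fun l => ξ l = w).card ≤ m := fun w _ =>
    (Finset.card_le_card fun l hl => by
      rw [Finset.mem_filter] at hl ⊢
      exact ⟨(Finset.mem_filter.1 hl.1).1, hl.2⟩).trans (hmult w)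
  calc F.card ≤ m * (F.image ξ).card := Finset.card_le_mul_card_image F m hfib
    _ ≤ m * (Finset.Icc (fun i => ξ j i - (r : ℤ)) (fun i => ξ j i + (r : ℤ))).card :=
        Nat.mul_le_mul_left m (Finset.card_le_card himg)
    _ = m * (2 * r + 1) ^ dd := by rw [card_box]

/-- **THE POLYNOMIAL GROWTH LETTER ON THE LATTICE** in the currency of §1: under a site reading with fibres `≤ m` and
coordinate differences dominated by `d`, `#{l ∈ D | d(j,l) < r+1} ≤ (m·2^d)·(r+1)^d`. [folklore] -/
theorem polyGrowth_of_siteReading [DecidableEq n] (D : Finset n) (d : n → n → ℝ) (j : n)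
    (ξ : n → (Fin dd → ℤ)) {m : ℕ} (hmult : ∀ w, (D.filter fun l => ξ l = w).card ≤ m)
    (hcoord : ∀ l ∈ D, ∀ i, |((ξ l i : ℤ) : ℝ) - ((ξ j i : ℤ) : ℝ)| ≤ d j l) (r : ℕ) :
    ((D.filter fun l => d j l < r + 1).card : ℝ) ≤ ((m : ℝ) * 2 ^ dd) * ((r : ℝ) + 1) ^ dd := by
  have h1 : ((D.filter fun l => d j l < r + 1).card : ℝ) ≤ (m : ℝ) * (2 * (r : ℝ) + 1) ^ dd := by
    exact_mod_cast card_filter_le_of_siteReading D d j ξ hmult hcoord r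
  have h2 : (2 * (r : ℝ) + 1) ^ dd ≤ (2 * ((r : ℝ) + 1)) ^ dd :=
    pow_le_pow_left₀ (by positivity) (by linarith) dd
  calc ((D.filter fun l => d j l < r + 1).card : ℝ) ≤ (m : ℝ) * (2 * (r : ℝ) + 1) ^ dd := h1
    _ ≤ (m : ℝ) * (2 * ((r : ℝ) + 1)) ^ dd := mul_le_mul_of_nonneg_left h2 (Nat.cast_nonneg m)
    _ = ((m : ℝ) * 2 ^ dd) * ((r : ℝ) + 1) ^ dd := by rw [mul_pow]; ring

/-- **THE LATTICE DECAY SUM WITH A BUFFER, VOLUME-FREE**: under a site reading with fibres `≤ m`, coordinate differences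
dominated by `d`, `μ > 0` and the buffer `d(j, D) ≥ R`,
`Σ_{l∈D} e^{−μ d(j,l)} ≤ (m·2^d)·(d!∕(μ∕2)^d)·e^{μ∕2}∕(1 − e^{−μ∕2}) · e^{−(μ∕2)R}`. [folklore] -/
theorem sum_exp_le_of_siteReading [DecidableEq n] (D : Finset n) (d : n → n → ℝ) (j : n)
    (ξ : n → (Fin dd → ℤ)) {m : ℕ} (hmult : ∀ w, (D.filter fun l => ξ l = w).card ≤ m)
    (hcoord : ∀ l ∈ D, ∀ i, |((ξ l i : ℤ) : ℝ) - ((ξ j i : ℤ) : ℝ)| ≤ d j l) {μ : ℝ} (hμ : 0 < μ)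
    {R : ℕ} (hR : ∀ l ∈ D, (R : ℝ) ≤ d j l) :
    ∑ l ∈ D, exp (-(μ * d j l)) ≤
      ((m : ℝ) * 2 ^ dd) * ((dd.factorial : ℝ) / (μ / 2) ^ dd) * exp (μ / 2) / (1 - exp (-(μ / 2))) *
        exp (-(μ / 2 * R)) :=
  sum_exp_le_of_polyGrowth D d j hμ (by positivity) (polyGrowth_of_siteReading D d j ξ hmult hcoord) hR

end Lattice

/-! ## §3 Junctions BY NAME: the induced mean, the response map and `B₀` without `#D` -/

section Junction
variable [Fintype n] [DecidableEq n]

/-- **THE INDUCED MEAN UNDER A DECAY LETTER AND A GROWTH LETTER** (= `…GaussianInducedMeanDecay.abs_inv_mulVec_le_sum` +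
`sum_exp_le_of_growth`): decay `|S⁻¹ i k| ≤ C·e^{−μ d(i,k)}`, exterior term `v` supported on `D` with `|v| ≤ V` (`V ≥ 0`)
there, growth letter `#{l ∈ D | d(j,l) < r+1} ≤ A·e^{ν(r+1)}` (`0 ≤ ν < μ`), buffer `d(j, D) ≥ R` ⟹
`|(S⁻¹v) j| ≤ C·V·(A·e^ν∕(1−e^{−(μ−ν)})·e^{−(μ−ν)R})` — no `#D`. [folklore] -/
theorem abs_inv_mulVec_le_growth (S : Matrix n n ℝ) {C μ : ℝ} (d : n → n → ℝ)
    (hdec : ∀ i k, |S⁻¹ i k| ≤ C * Real.exp (-(μ * d i k)))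
    (D : Finset n) (v : n → ℝ) (hvD : ∀ l, l ∉ D → v l = 0) {V : ℝ} (hV0 : 0 ≤ V) (hV : ∀ l ∈ D, |v l| ≤ V)
    (j : n) {ν A : ℝ} (hν : 0 ≤ ν) (hνμ : ν < μ)
    (hgrowth : ∀ r : ℕ, ((D.filter fun l => d j l < r + 1).card : ℝ) ≤ A * exp (ν * (r + 1)))
    {R : ℕ} (hR : ∀ l ∈ D, (R : ℝ) ≤ d j l) :
    |(S⁻¹ *ᵥ v) j| ≤ C * V * (A * exp ν / (1 - exp (-(μ - ν))) * exp (-((μ - ν) * R))) :=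
  (abs_inv_mulVec_le_sum S d hdec D v hvD hV j).trans
    (mul_le_mul_of_nonneg_left (sum_exp_le_of_growth D d j hν hνμ hgrowth hR)
      (mul_nonneg (decayConst_nonneg S d hdec j) hV0))

/-- **THE RESPONSE MAP'S ROW SUMS WITHOUT `#D`** (σ-1's letter `t_Z`, volume-free): under a decay letter for `S⁻¹`, a
coupling `S₁₂` living on the rows `D` with absolute row sums `≤ s` (`s ≥ 0`), the growth letter at `j` and the buffer
`d(j, D) ≥ R`: `Σ_a |(S⁻¹S₁₂) j a| ≤ C·s·(A·e^ν∕(1−e^{−(μ−ν)})·e^{−(μ−ν)R})`. [folklore] -/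
theorem rowSum_response_le_growth {m : Type*} [Fintype m] (S : Matrix n n ℝ) {C μ : ℝ} (d : n → n → ℝ)
    (hdec : ∀ i k, |S⁻¹ i k| ≤ C * Real.exp (-(μ * d i k))) (S₁₂ : Matrix n m ℝ) (D : Finset n)
    (hrow : ∀ l a, S₁₂ l a ≠ 0 → l ∈ D) {s : ℝ} (hs0 : 0 ≤ s) (hs : ∀ l, ∑ a, |S₁₂ l a| ≤ s) (j : n)
    {ν A : ℝ} (hν : 0 ≤ ν) (hνμ : ν < μ)
    (hgrowth : ∀ r : ℕ, ((D.filter fun l => d j l < r + 1).card : ℝ) ≤ A * exp (ν * (r + 1)))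
    {R : ℕ} (hR : ∀ l ∈ D, (R : ℝ) ≤ d j l) :
    ∑ a, |(S⁻¹ * S₁₂) j a| ≤ C * s * (A * exp ν / (1 - exp (-(μ - ν))) * exp (-((μ - ν) * R))) :=
  (rowSum_response_le S d hdec S₁₂ D hrow hs j).trans
    (mul_le_mul_of_nonneg_left (sum_exp_le_of_growth D d j hν hνμ hgrowth hR)
      (mul_nonneg (decayConst_nonneg S d hdec j) hs0))

/-- **THE INDUCED-MEAN ENERGY `B₀` WITHOUT `#D`** (residual (R1″) ∕ (R1′b) in model form, volume-free): decay letter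
`|S⁻¹ i k| ≤ C·e^{−μ d(i,k)}`; `Q` positive semidefinite living on `Z` with `Q ≤ q₀·1` (`q₀ ≥ 0`); exterior term `v`
supported on the interface `D` with `|v| ≤ V` (`V ≥ 0`) there; the growth letter at every `i ∈ Z` (`0 ≤ ν < μ`); buffer
`d(i,l) ≥ R` for `i ∈ Z`, `l ∈ D`.  Then, for `m = S⁻¹v`,
`mᵀQm ≤ q₀·#Z·(C·V·(A·e^ν∕(1−e^{−(μ−ν)}))·e^{−(μ−ν)R})²` — `O(q₀#Z)` as soon as `e^{(μ−ν)R} ≥ C·V·A·e^ν∕(1−e^{−(μ−ν)})`, a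
buffer INDEPENDENT of the far component and of the volume. [folklore] -/
theorem inducedMeanEnergy_le_of_growth (S Q : Matrix n n ℝ) {C μ : ℝ} (d : n → n → ℝ)
    (hdec : ∀ i k, |S⁻¹ i k| ≤ C * Real.exp (-(μ * d i k)))
    (hQ : Q.PosSemidef) (Z : Finset n) (hQZ : ∀ i j, j ∉ Z → Q i j = 0) {q₀ : ℝ} (hq₀ : 0 ≤ q₀)
    (hQq : (q₀ • (1 : Matrix n n ℝ) - Q).PosSemidef)
    (D : Finset n) (v : n → ℝ) (hvD : ∀ l, l ∉ D → v l = 0) {V : ℝ} (hV0 : 0 ≤ V) (hV : ∀ l ∈ D, |v l| ≤ V)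
    {ν A : ℝ} (hν : 0 ≤ ν) (hνμ : ν < μ)
    (hgrowth : ∀ i ∈ Z, ∀ r : ℕ, ((D.filter fun l => d i l < r + 1).card : ℝ) ≤ A * exp (ν * (r + 1)))
    {R : ℕ} (hR : ∀ i ∈ Z, ∀ l ∈ D, (R : ℝ) ≤ d i l) :
    (S⁻¹ *ᵥ v) ⬝ᵥ (Q *ᵥ (S⁻¹ *ᵥ v)) ≤
      q₀ * Z.card * (C * V * (A * exp ν / (1 - exp (-(μ - ν))) * exp (-((μ - ν) * R)))) ^ 2 :=
  qf_le_card_mul_sq hQ Z hQZ hQq hq₀ _ fun i hi =>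
    abs_inv_mulVec_le_growth S d hdec D v hvD hV0 hV i hν hνμ (hgrowth i hi) (hR i hi)

/-- **THE SAME, FED BY COMBES–THOMAS** (`C = 2∕σ` from `…GaussianInducedMeanDecay.abs_inv_le_of_banded`): for a coercive
banded `S`, the induced-mean energy on a pinned region `R` layers inside is at most
`q₀·#Z·((2∕σ)·V·(A·e^ν∕(1−e^{−(μ−ν)}))·e^{−(μ−ν)R})²` — volume-free. [folklore] -/
theorem inducedMeanEnergy_le_of_banded_growth (S Q : Matrix n n ℝ) (d : n → n → ℝ) (σ h z μ : ℝ) (hσ : 0 < σ)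
    (hμ : 0 ≤ μ) (hd0 : ∀ i, d i i = 0) (hdsymm : ∀ i k, d i k = d k i) (hdtri : ∀ i j k, d i k ≤ d i j + d j k)
    (hband : ∀ i k, 1 < d i k → S i k = 0) (hh0 : 0 ≤ h) (hh : ∀ i k, i ≠ k → |S i k| ≤ h)
    (hz : ∀ i, ((univ.filter fun k => k ≠ i ∧ d i k ≤ 1).card : ℝ) ≤ z)
    (hpos : ∀ ω : n → ℝ, σ * (ω ⬝ᵥ ω) ≤ ω ⬝ᵥ S *ᵥ ω) (hsmall : h * z * (Real.exp μ - 1) ≤ σ / 2)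
    (hQ : Q.PosSemidef) (Z : Finset n) (hQZ : ∀ i j, j ∉ Z → Q i j = 0) {q₀ : ℝ} (hq₀ : 0 ≤ q₀)
    (hQq : (q₀ • (1 : Matrix n n ℝ) - Q).PosSemidef)
    (D : Finset n) (v : n → ℝ) (hvD : ∀ l, l ∉ D → v l = 0) {V : ℝ} (hV0 : 0 ≤ V) (hV : ∀ l ∈ D, |v l| ≤ V)
    {ν A : ℝ} (hν : 0 ≤ ν) (hνμ : ν < μ)
    (hgrowth : ∀ i ∈ Z, ∀ r : ℕ, ((D.filter fun l => d i l < r + 1).card : ℝ) ≤ A * exp (ν * (r + 1)))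
    {R : ℕ} (hR : ∀ i ∈ Z, ∀ l ∈ D, (R : ℝ) ≤ d i l) :
    (S⁻¹ *ᵥ v) ⬝ᵥ (Q *ᵥ (S⁻¹ *ᵥ v)) ≤
      q₀ * Z.card * (2 / σ * V * (A * exp ν / (1 - exp (-(μ - ν))) * exp (-((μ - ν) * R)))) ^ 2 :=
  inducedMeanEnergy_le_of_growth S Q d
    (abs_inv_le_of_banded S d σ h z μ hσ hμ hd0 hdsymm hdtri hband hh0 hh hz hpos hsmall)
    hQ Z hQZ hq₀ hQq D v hvD hV0 hV hν hνμ hgrowth hR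

/-- **THE SHIFTED RESTRICTED MOMENT WITH THE VOLUME-FREE BUFFER PRICE** = the OWNER's
`…GaussianShiftedFibre.shiftedMoment_le_of_inducedMean_le` with its displayed `hB` DISCHARGED by
`inducedMeanEnergy_le_of_growth`: the exterior coupling costs `exp((1+ε⁻¹)·q₀·#Z·(C·V·Γ·e^{−(μ−ν)R})²)`,
`Γ = A·e^ν∕(1−e^{−(μ−ν)})` — free of the far volume, of `#D` and of the far characteristic functions.  The translated
mass `hmass` stays displayed (window clause (R1′c), `…GaussianInducedMeanDecay` §6 ∕ `…GaussianInducedMeanWindow`).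
[folklore] -/
theorem shiftedMoment_le_of_growth {S Q : Matrix n n ℝ} {δ' ε η : ℝ} {r : ℕ} (hS : S.PosDef) (hQ : Q.PosSemidef)
    (hε : 0 < ε) (hdom : (δ' • S - (1 + ε) • Q).PosSemidef) (hδ0 : 0 ≤ δ') (hδ : δ' < 1) (hr : Q.rank ≤ r)
    (v : n → ℝ) {F : (n → ℝ) → ℝ} (hF0 : ∀ x, 0 ≤ F x) (hF1 : ∀ x, F x ≤ 1) (hFm : Measurable F) (hη : η < 1)
    (hmass : ∫ u, (1 - F (u - S⁻¹ *ᵥ v)) * exp (-(u ⬝ᵥ (S *ᵥ u))) ≤ η * ∫ u, exp (-(u ⬝ᵥ (S *ᵥ u))))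
    {C μ : ℝ} (d : n → n → ℝ) (hdec : ∀ i k, |S⁻¹ i k| ≤ C * Real.exp (-(μ * d i k)))
    (Z : Finset n) (hQZ : ∀ i j, j ∉ Z → Q i j = 0) {q₀ : ℝ} (hq₀ : 0 ≤ q₀)
    (hQq : (q₀ • (1 : Matrix n n ℝ) - Q).PosSemidef)
    (D : Finset n) (hvD : ∀ l, l ∉ D → v l = 0) {V : ℝ} (hV0 : 0 ≤ V) (hV : ∀ l ∈ D, |v l| ≤ V)
    {ν A : ℝ} (hν : 0 ≤ ν) (hνμ : ν < μ)
    (hgrowth : ∀ i ∈ Z, ∀ r' : ℕ, ((D.filter fun l => d i l < r' + 1).card : ℝ) ≤ A * exp (ν * (r' + 1)))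
    {R : ℕ} (hR : ∀ i ∈ Z, ∀ l ∈ D, (R : ℝ) ≤ d i l) :
    ∫ x, F x * (exp (x ⬝ᵥ (Q *ᵥ x)) * exp (-(x ⬝ᵥ (S *ᵥ x) + 2 * (x ⬝ᵥ v)))) ≤
      (exp ((1 + ε⁻¹) *
          (q₀ * Z.card * (C * V * (A * exp ν / (1 - exp (-(μ - ν))) * exp (-((μ - ν) * R)))) ^ 2)) *
          ((√(1 - δ'))⁻¹ ^ r / (1 - η))) *
        ∫ x, F x * exp (-(x ⬝ᵥ (S *ᵥ x) + 2 * (x ⬝ᵥ v))) :=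
  shiftedMoment_le_of_inducedMean_le hS hQ hε hdom hδ0 hδ hr v hF0 hF1 hFm hη hmass
    (inducedMeanEnergy_le_of_growth S Q d hdec hQ Z hQZ hq₀ hQq D v hvD hV0 hV hν hνμ hgrowth hR)

/-- **`B₀` UNDER THE POLYNOMIAL LETTER**: with `#{l ∈ D | d(i,l) < r+1} ≤ A·(r+1)^k` at every `i ∈ Z` (`A ≥ 0`, `μ > 0`)
and the buffer, `mᵀQm ≤ q₀·#Z·(C·V·(A·(k!∕(μ∕2)^k)·e^{μ∕2}∕(1−e^{−μ∕2}))·e^{−(μ∕2)R})²`. [folklore] -/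
theorem inducedMeanEnergy_le_of_polyGrowth (S Q : Matrix n n ℝ) {C μ : ℝ} (d : n → n → ℝ) (hμ : 0 < μ)
    (hdec : ∀ i k, |S⁻¹ i k| ≤ C * Real.exp (-(μ * d i k)))
    (hQ : Q.PosSemidef) (Z : Finset n) (hQZ : ∀ i j, j ∉ Z → Q i j = 0) {q₀ : ℝ} (hq₀ : 0 ≤ q₀)
    (hQq : (q₀ • (1 : Matrix n n ℝ) - Q).PosSemidef)
    (D : Finset n) (v : n → ℝ) (hvD : ∀ l, l ∉ D → v l = 0) {V : ℝ} (hV0 : 0 ≤ V) (hV : ∀ l ∈ D, |v l| ≤ V)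
    {A : ℝ} {k : ℕ} (hA : 0 ≤ A)
    (hgrowth : ∀ i ∈ Z, ∀ r : ℕ, ((D.filter fun l => d i l < r + 1).card : ℝ) ≤ A * ((r : ℝ) + 1) ^ k)
    {R : ℕ} (hR : ∀ i ∈ Z, ∀ l ∈ D, (R : ℝ) ≤ d i l) :
    (S⁻¹ *ᵥ v) ⬝ᵥ (Q *ᵥ (S⁻¹ *ᵥ v)) ≤
      q₀ * Z.card * (C * V *
        (A * ((k.factorial : ℝ) / (μ / 2) ^ k) * exp (μ / 2) / (1 - exp (-(μ / 2))) * exp (-(μ / 2 * R)))) ^ 2 :=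
  qf_le_card_mul_sq hQ Z hQZ hQq hq₀ _ fun i hi =>
    (abs_inv_mulVec_le_sum S d hdec D v hvD hV i).trans
      (mul_le_mul_of_nonneg_left (sum_exp_le_of_polyGrowth D d i hμ hA (hgrowth i hi) (hR i hi))
        (mul_nonneg (decayConst_nonneg S d hdec i) hV0))

/-- **`B₀` ON THE LATTICE, VOLUME-FREE** — the refuter's «`Σ_{r≥R} N_d(r)e^{−μr}`» END TO END: indices read on `ℤ^d` by
`ξ` with fibres `≤ m` on `D` and coordinate differences dominated by `d` at every `i ∈ Z`; decay letter (`μ > 0`), `Q`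
on `Z` with `Q ≤ q₀·1`, exterior term on `D` with `|v| ≤ V`, buffer `R`.  Then
`mᵀQm ≤ q₀·#Z·(C·V·((m·2^d)·(d!∕(μ∕2)^d)·e^{μ∕2}∕(1−e^{−μ∕2}))·e^{−(μ∕2)R})²` — no `#D`, no volume: the buffer that
makes `B₀ = O(q₀#Z)` is `R ≥ (2∕μ)·log(C·V·m·2^d·d!·(2∕μ)^d·e^{μ∕2}∕(1−e^{−μ∕2}))`, INDEPENDENT of the far component.
[folklore] -/
theorem inducedMeanEnergy_le_of_siteReading {dd : ℕ} (S Q : Matrix n n ℝ) {C μ : ℝ} (d : n → n → ℝ) (hμ : 0 < μ)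
    (hdec : ∀ i k, |S⁻¹ i k| ≤ C * Real.exp (-(μ * d i k)))
    (hQ : Q.PosSemidef) (Z : Finset n) (hQZ : ∀ i j, j ∉ Z → Q i j = 0) {q₀ : ℝ} (hq₀ : 0 ≤ q₀)
    (hQq : (q₀ • (1 : Matrix n n ℝ) - Q).PosSemidef)
    (D : Finset n) (v : n → ℝ) (hvD : ∀ l, l ∉ D → v l = 0) {V : ℝ} (hV0 : 0 ≤ V) (hV : ∀ l ∈ D, |v l| ≤ V)
    (ξ : n → (Fin dd → ℤ)) {m : ℕ} (hmult : ∀ w, (D.filter fun l => ξ l = w).card ≤ m)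
    (hcoord : ∀ i ∈ Z, ∀ l ∈ D, ∀ c, |((ξ l c : ℤ) : ℝ) - ((ξ i c : ℤ) : ℝ)| ≤ d i l)
    {R : ℕ} (hR : ∀ i ∈ Z, ∀ l ∈ D, (R : ℝ) ≤ d i l) :
    (S⁻¹ *ᵥ v) ⬝ᵥ (Q *ᵥ (S⁻¹ *ᵥ v)) ≤
      q₀ * Z.card * (C * V *
        (((m : ℝ) * 2 ^ dd) * ((dd.factorial : ℝ) / (μ / 2) ^ dd) * exp (μ / 2) / (1 - exp (-(μ / 2))) *
          exp (-(μ / 2 * R)))) ^ 2 :=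
  inducedMeanEnergy_le_of_polyGrowth S Q d hμ hdec hQ Z hQZ hq₀ hQq D v hvD hV0 hV (by positivity)
    (fun i hi => polyGrowth_of_siteReading D d i ξ hmult (hcoord i hi)) hR

end Junction

/-! ## §4 A decided toy: three indices read on `ℤ¹` by `l ↦ l`, distance `|l − j|`, multiplicity `1` — the site-reading
hypotheses hold and the count reads `#{l | |l − j| < r+1} ≤ 1·(2r+1)^1` -/

example (j : Fin 3) (r : ℕ) :
    ((Finset.univ : Finset (Fin 3)).filter fun l : Fin 3 => (|((l : ℕ) : ℝ) - ((j : ℕ) : ℝ)| : ℝ) < r + 1).card ≤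
      1 * (2 * r + 1) ^ 1 := by
  refine card_filter_le_of_siteReading (Finset.univ : Finset (Fin 3))
    (fun (j l : Fin 3) => |((l : ℕ) : ℝ) - ((j : ℕ) : ℝ)|) j
    (fun (l : Fin 3) => fun _ : Fin 1 => ((l : ℕ) : ℤ)) (m := 1) (fun w => ?_) (fun l _ i => ?_) r
  · refine (Finset.card_le_one.2 fun a ha b hb => ?_)
    rw [Finset.mem_filter] at ha hb
    have h : ((a : ℕ) : ℤ) = ((b : ℕ) : ℤ) := (congr_fun ha.2 0).trans (congr_fun hb.2 0).symm
    exact Fin.ext (by exact_mod_cast h)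
  · simp only [Int.cast_natCast, le_refl]

end Summit.QuantumFields.BalabanUV.T4Continuum.NE7b.InducedMeanLatticeGrowth
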